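import Summits.AtomisticToContinuum.HydrodynamicLimit.Theorems.OneFlightGossipEngineClampedCurrentsDockStaticLimit
import Summits.AtomisticToContinuum.HydrodynamicLimit.Theorems.OneFlightGossipEngineClampedCurrentsDockStaticTelescoping
import Summits.AtomisticToContinuum.HydrodynamicLimit.Theorems.DenseExcursion.Negative.Everywhere
import HarnessLib

/-!
# The static clause of the heart `OneWindowLedger`, in band (stub `stub_staticClause`, line `IdeatorOneSketch`,
# crux `HydroLimitInBand`, stmt-AtomisticToContinuum-9133; skeleton v11)

Support file (`--supports stmt-AtomisticToContinuum-9133`). Registered stub (skeleton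
`Cruxes/HydroLimitInBand/Lines/IdeatorOneSketch.lean`, v11): `stub_staticClause : StaticClauseInBand` (the def re-declared verbatim
from the line skeleton, this file's namespace). Proof: the sibling crux 14680's landed SC-b
`ClampedCurrentsDockStaticLimit.stub_staticLimit` and SC-a `ClampedCurrentsDockStaticTelescoping.stub_staticTelescoping` (with
`ℓ := −Cst`), unit mass along the tied solution from `DenseExcursionEverywhere.integral_density_eq` /
`integral_density_zero_eq_one`.
-/

noncomputable section

open MeasureTheory Filter Set Topology InformationTheory
open scoped ENNReal

namespace Summit.AtomisticToContinuum.HydrodynamicLimit.Theorems.HydroLimitInBandHeart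

open Literature.MathematicalPhysics.KineticTheory Literature.Analysis.FluidPDE Literature.Analysis.FunctionSpaces
open Summit.AtomisticToContinuum.HydrodynamicLimit.Theorems

/-- registered stub signature `stub_staticClause` of line IdeatorOneSketch, crux HydroLimitInBand (stmt-9133) — route-internal
proposition in the vocabulary of the crux, not a cited fact -/
def StaticClauseInBand : Prop :=
  ∀ (r : ℝ) (Rf : ℝ → ℝ), 0 < r →
    (∃ p : FormalMultilinearSeries ℝ ℝ ℝ, HasFPowerSeriesOnBall Rf p 0 (ENNReal.ofReal r)) →
    (∃ L : NNReal, LipschitzOnWith L Rf (Icc 0 r)) →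
    (∀ x ∈ Ioo (-r) r, 0 < Rf x ∧ Rf x * (∑' j : ℕ, bE j / (j.factorial : ℝ) * (x * Rf x) ^ j) = 1) →
    (∀ x ∈ Icc 0 r, 1 ≤ Rf x ∧ Rf x ≤ 2) → ContinuousOn Rf (Icc 0 r) →
    (∀ x ∈ Ioo (-r) r, ∀ R ∈ Icc (1 / 2 : ℝ) 2,
      R * (∑' j : ℕ, bE j / (j.factorial : ℝ) * (x * R) ^ j) = 1 → R = Rf x) →
    ∃ ηs : ℝ, 0 < ηs ∧
    ∀ (a₀ θ₀ : T3 → ℝ) (u₀ : T3 → V3), Continuous a₀ → Continuous θ₀ → Continuous u₀ →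
      (∀ x, 0 < a₀ x) → (∀ x, 0 < θ₀ x) →
      ∀ σ : ℝ, 0 < σ → σ < 1 / 2 →
        ∀ (T : ℝ) (ρ θ : ℝ → T3 → ℝ) (u : ℝ → T3 → V3), IsHardSphereEulerSolution σ T ρ u θ →
          (∀ s ∈ Set.Ico 0 T, ∀ x, ρ s x * σ ^ 3 < ηs) →
          ∀ Φ : (N : ℕ) → HardSphereFlow (Torus.geometry (Fin 3)) (hsDiameter σ N) (N + 1),
            TendstoHydroFieldsAt (fun N => localGibbsLaw σ a₀ u₀ θ₀ N (Φ N)) Φ ρ u θ 0 →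
            ∀ t ∈ Set.Ioo 0 T,
              ContinuousOn (fun s : ℝ => ∫ x, ρ s x * (ρ s x * σ ^ 3) * deriv hsCompressibility (ρ s x * σ ^ 3) *
                  Torus.divergence (u s) x) (Set.Icc 0 t) ∧
              ∀ ε : ℝ, 0 < ε → ∃ N₀ : ℕ, ∀ N : ℕ, N₀ ≤ N → ∀ t' ∈ Set.Icc 0 t,
                |Real.log (posPartition (fun x => ρ t' x * Rf (σ ^ 3 * ρ t' x)) (hsDiameter σ N) (N + 1)) -
                    Real.log (posPartition (fun x => ρ 0 x * Rf (σ ^ 3 * ρ 0 x)) (hsDiameter σ N) (N + 1)) +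
                  ((N : ℝ) + 1) * ∫ r in (0 : ℝ)..t',
                    (∫ x, ρ r x * (ρ r x * σ ^ 3) * deriv hsCompressibility (ρ r x * σ ^ 3) *
                      Torus.divergence (u r) x)| ≤ ((N : ℝ) + 1) * ε

/-- **The static clause of the heart, in band.** Pure plumbing of the sibling crux's landed static channel:
`ClampedCurrentsDockStaticLimit.stub_staticLimit` (smoothness/positivity of `a = ρ Rf(σ³ρ)`, `Z_pos > 0`,
continuity of `Cst`, the `O(N+1)` bound and the limit `D_N/(N+1) → −Cst` of the canonical means; its unit-mass
hypothesis is discharged along the tied solution by `DenseExcursionEverywhere.integral_density_eq` and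
`integral_density_zero_eq_one`) fed into `ClampedCurrentsDockStaticTelescoping.stub_staticTelescoping` with
`ℓ := −Cst`, and `∫ (−Cst) = −∫ Cst`. [cite: Yau1991, §2] -/
theorem stub_staticClause : StaticClauseInBand := by
  intro r Rf hr hps hLip hsol hbd hcont huniq
  obtain ⟨ηs, hηs, H⟩ :=
    ClampedCurrentsDockStaticLimit.stub_staticLimit r Rf hr hps hLip hsol hbd hcont huniq
  refine ⟨ηs, hηs, ?_⟩
  intro a₀ θ₀ u₀ ha hθ hu ha0 hθ0 σ hσ hσ2 T ρ θ u hE hguard Φ htie t ht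
  -- unit mass along the tied solution
  have hmass : ∀ s ∈ Ico 0 T, ∫ x, ρ s x = 1 := fun s hs =>
    (DenseExcursionEverywhere.integral_density_eq hE hs).trans
      (DenseExcursionEverywhere.integral_density_zero_eq_one hσ2.le ha hθ hu ha0 hθ0 Φ htie)
  -- the statics half (SC-b)
  obtain ⟨hsm, hpos, hZpos, hCc, ⟨M, hM⟩, hlim⟩ := H σ hσ hσ2 T ρ θ u hE hguard hmass Φ t ht
  refine ⟨hCc, ?_⟩
  intro ε hε
  -- the analysis half (SC-a) with `ℓ := -Cst`
  obtain ⟨N₀, hN₀⟩ :=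
    ClampedCurrentsDockStaticTelescoping.stub_staticTelescoping σ T (fun s x => ρ s x * Rf (σ ^ 3 * ρ s x))
      hsm hpos hZpos t ht
      (fun s : ℝ => -∫ x, ρ s x * (ρ s x * σ ^ 3) * deriv hsCompressibility (ρ s x * σ ^ 3) *
        Torus.divergence (u s) x)
      hCc.neg M hM hlim ε hε
  refine ⟨N₀, fun N hN t' ht' => ?_⟩
  have h := hN₀ N hN t' ht'
  rwa [intervalIntegral.integral_neg, mul_neg, sub_neg_eq_add] at h

end Summit.AtomisticToContinuum.HydrodynamicLimit.Theorems.HydroLimitInBandHeart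

end
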